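import Literature.Barriers.QuantumAdvantage.UncorrectedNoiseIQP
import Literature.Probability.Percolation.ClusterExponentialMoment
import HarnessLib

/-!
# Bit-flipped IQP distributions: the open-set mixture, pinning, factorisation over the interaction graph

Topic `Literature/Computability/QuantumComplexity`, namespace
`Literature.Computability.QuantumComplexity.NoisyIQPPercolation`; typed beside the barrier entry A13
`Literature/Barriers/QuantumAdvantage/UncorrectedNoise.lean` (`SamplingProblem.withBitFlips`, BMS17 Thm 4) and
its support files `UncorrectedNoiseFourier.lean` (`noiseOp`, `flipWeight`, `flipAt`) / `UncorrectedNoiseIQP.lean`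
(`iqpProb`, `twistedPhase`, `circPhase`, `gatePhase`, `supp`, `hGateAll`, `iqpProb_eq_sum`), whose vocabulary is
reused throughout; the percolation side is `Literature/Probability/Percolation/ClusterExponentialMoment.lean`.

This is the percolation argument of Rajakumar–Watson–Liu [RajakumarWatsonLiu2025] for noisy IQP circuits,
re-expressed for the tree's `{Z, CZ, T}` circuits `QCircuit iqpDiag N` under OUTPUT BIT-FLIP noise of rate `η`
(the model of A13) as exact finite identities:

* §1 `bscKernel`, `noisyIqpProb` (`= noiseOp η (iqpProb D z)`, `noisyIqpProb_eq_noiseOp`), `marginalOn`;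
  record (A) `ErasureMixture` — the binary symmetric channel splits wire by wire as
  `BSC_η = (1−2η)·id + 2η·(uniform)`, so `bscKernel η y w = Σ_A (1−2η)^{|A|} η^{N−|A|} [y =_A w]`
  (the bit-level form of the split "`𝒩 = (1−2p)𝒩₁ + 2p 𝒩₂∘𝒩_{0,0,1/2}`" of
  [cite: RajakumarWatsonLiu2025, Lemma 3]); record (A′) `NoisyIsErasureMixture` — the bit-flipped IQP law is the
  corresponding mixture, over the OPEN SET `A`, of the marginals of the ideal law.
* §2 record (B) `PinningIdentity` (`marginal_iqpProb_eq_avg_pinned`) — the marginal on `A` of the IQP law is the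
  uniform average over the `2^{N−|A|}` pinned values of the closed wires of the PINNED IQP laws `pinnedProb`
  (the probability-level form of the pinning lemma [cite: RajakumarWatsonLiu2025, Lemma 5 and Lemma 4]: a
  completely dephased qubit is a uniformly random computational-basis pin), proved by Parseval on the closed
  sub-cube from the tree's `iqpProb_eq_sum` via the partial character sum `sum_agree_walsh`.
* §3 `Straddles`, `intGraph` (the interaction graph), record (C) `ComponentFactorisation` — pinned laws multiply
  across open parts that no gate straddles ("the edges of its corresponding vertex in the interaction graph are
  essentially removed" [cite: RajakumarWatsonLiu2025, §3.1.1 (after Lemma 5)]; exactness of the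
  component-wise simulation [cite: RajakumarWatsonLiu2025, Lemma 8]), proved from gate locality
  (`gatePhase_congr`) and a bijection of pinned strings; (S3) `NoEdgeNoStraddle`.
* §4 `zOn`, `dephase`, `bornDiag`; records (E1) `DephaseCommutesDiagonal`, (E2) `DephaseCompose`
  (`1 − 2η″ = (1−2η)(1−2η′)`), (E3) `DephaseIsOutputBitflip` (`H^{⊗N} Z_j H^{⊗N} = X_j`) — "these dephasing
  channels commute through the circuit and become bit-flip errors on the output"
  [cite: RajakumarWatsonLiu2025, §5.1 (proof of Theorem 13)], so `d` interspersed dephasing layers of rate `p`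
  are output bit flips of rate `η_d`, `1 − 2η_d = (1−2p)^d`.
* §5 `IQPBitflipPercolationThreshold` — the conjunction (A′) ∧ (B) ∧ (C) ∧ `LambertThreshold` ∧ (E2) ∧ (E3),
  PROVED (`iqpBitflipPercolationThreshold_holds`; the percolation constant `Δ(1−2η) ≤ μ⋆ = 0.2319…` comes from
  `ClusterExponentialMoment.lambertThreshold_holds`), and the animal-level variant
  `iqpBitflipAnimalThreshold_holds`.

HONEST FRAMING (cell qa-dq, line `iqp-bitflip-percolation-threshold`, census DQ-N9). Everything below is an
exact identity or an elementary inequality about the tree's IQP output probabilities under output bit-flip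
noise and about one cost functional of site percolation on the interaction graph; no sampling procedure is
described or built (RWL's Algorithm 7 is cited as the print source of the pinning identity, not implemented),
nothing is claimed about any other simulator or about hardness, and nothing here proves or refutes a quantum
advantage.

## References

* [RajakumarWatsonLiu2025] J. Rajakumar, J. D. Watson, Y.-K. Liu, *Polynomial-time classical simulation of
  noisy IQP circuits with constant depth*, SODA 2025, 1037–1056, arXiv:2403.14607 — Lemma 3 (noise split),
  Lemma 4 / Lemma 5 (dephased qubits are pinned; eq. (3)), §3.1.1–3.1.2 (interaction graph, vertex
  percolation), Algorithm 7 / Lemma 8 (exactness), §5.1 (dephasing ↦ output bit flips, `(1−2p)^d`).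
* [BremnerMontanaroShepherd2017] M. J. Bremner, A. Montanaro, D. J. Shepherd, *Achieving quantum supremacy
  with sparse and noisy commuting quantum computations*, Quantum 1 (2017) 8 — §1, §3 (the bit-flip noise
  operator `𝒩_ε`; the tree's `noiseOp`, `iqpProb_eq_sum`).
* [ODonnell2014] R. O'Donnell, *Analysis of Boolean Functions*, CUP 2014 — §1.4 (characters, Parseval).
* [NielsenChuang2010] M. A. Nielsen, I. L. Chuang, *Quantum Computation and Quantum Information*, CUP 2010 —
  §1.4.4 eq. (1.50) (`H^{⊗N}` entries), §8.3.6 (phase damping / dephasing channel).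
-/

noncomputable section

namespace Literature.Computability.QuantumComplexity.NoisyIQPPercolation

open Finset
open Literature.Computability.Cryptography
open Literature.Barriers.QuantumAdvantage (iqpProb twistedPhase circPhase supp flipAt noiseOp flipWeight bxor
  bxorEquiv bxor_comm)
open Literature.Probability.RandomGraphs.LowDegree (walsh sgn)
open Literature.Probability.Percolation.ClusterExponentialMoment (AnimalRung LambertThreshold animalRung_holds
  lambertThreshold_holds)
open scoped Matrix

variable {N : ℕ}

/-! ## §1 Output bit-flip noise on registers, explicitly -/

/-- The binary-symmetric-channel kernel on `N` bits: flip each bit independently with probability `η`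
(`= flipWeight η (y ⊕ w)`). [cite: BremnerMontanaroShepherd2017, §1 (noise model)] -/
def bscKernel (η : ℝ) (y w : QReg N) : ℝ := ∏ i, (if y i = w i then 1 - η else η)

/-- The bit-flipped IQP output distribution `p̃_z(w) = Σ_y p_z(y) · BSC_η(y → w)` (input basis string `z`).
[cite: BremnerMontanaroShepherd2017, §3 (p̃ = 𝒩_ε p)] -/
def noisyIqpProb (D : QCircuit iqpDiag N) (η : ℝ) (z w : QReg N) : ℝ := ∑ y, iqpProb D z y * bscKernel η y w

/-- The marginal of `P` on the coordinates `A`, read at `w` (depends on `w|_A` only).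
[cite: BremnerMontanaroShepherd2017, §3.1 (marginals)] -/
def marginalOn (A : Finset (Fin N)) (P : QReg N → ℝ) (w : QReg N) : ℝ :=
  ∑ y, if (∀ i ∈ A, y i = w i) then P y else 0

/-- `noisyIqpProb` IS the tree's bit-flip noise operator applied to the ideal law:
`p̃_z = noiseOp η (iqpProb D z)` (hence the mass function of `withBitFlips η` of the Born law, by
`toReal_bind_noisePMF_apply`). [cite: BremnerMontanaroShepherd2017, §3 (p̃ = 𝒩_ε p)] -/
theorem noisyIqpProb_eq_noiseOp (D : QCircuit iqpDiag N) (η : ℝ) (z w : QReg N) :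
    noisyIqpProb D η z w = noiseOp η (iqpProb D z) w := by
  have hb : ∀ a c : Bool, (if (a ^^ c) = c then (1 - η) else η) = if a = true then η else 1 - η := by
    intro a c; cases a <;> cases c <;> simp
  have hker : ∀ e : QReg N, bscKernel η (bxor e w) w = flipWeight η e := by
    intro e
    unfold bscKernel Literature.Barriers.QuantumAdvantage.flipWeight
    refine Finset.prod_congr rfl fun i _ => ?_
    simp only [Literature.Barriers.QuantumAdvantage.bxor]
    exact hb (e i) (w i)
  unfold noisyIqpProb Literature.Barriers.QuantumAdvantage.noiseOp
  rw [← Equiv.sum_comp (bxorEquiv w) (fun y => iqpProb D z y * bscKernel η y w)]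
  refine Finset.sum_congr rfl fun e _ => ?_
  simp only [Literature.Barriers.QuantumAdvantage.bxorEquiv, Equiv.coe_fn_mk]
  rw [hker, bxor_comm e w, mul_comm]

/-- Record (A) ERASURE MIXTURE: `BSC_η = (1−2η)·[y = w] + η` per wire, expanded over open sets `A`
(`(1−2η)^{|A|}` open, dead bits carry `η^{N−|A|}·[anything]`, i.e. `(2η)^{N−|A|}` times the uniform
`2^{−(N−|A|)}`) — the bit-level form of the split `𝒩 = (1−2p)·𝒩₁ + 2p·(complete dephasing)`.
[cite: RajakumarWatsonLiu2025, Lemma 3] -/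
def ErasureMixture : Prop :=
  ∀ {N : ℕ} (η : ℝ) (y w : QReg N),
    bscKernel η y w = ∑ A : Finset (Fin N),
      (1 - 2 * η) ^ A.card * η ^ (N - A.card) * (if (∀ i ∈ A, y i = w i) then 1 else 0)

/-- Record (A′): the bit-flipped IQP distribution is the open-set mixture of the marginals of the ideal one.
[cite: RajakumarWatsonLiu2025, Lemma 3 and Lemma 4] -/
def NoisyIsErasureMixture : Prop :=
  ∀ {N : ℕ} (D : QCircuit iqpDiag N) (η : ℝ) (z w : QReg N),
    noisyIqpProb D η z w = ∑ A : Finset (Fin N),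
      (1 - 2 * η) ^ A.card * η ^ (N - A.card) * marginalOn A (iqpProb D z) w

/-- Record (A), proved: `Finset.prod_add` over the per-wire split `BSC = (1−2η)·[=] + η`.
[cite: RajakumarWatsonLiu2025, Lemma 3] -/
theorem bscKernel_eq_sum (η : ℝ) (y w : QReg N) :
    bscKernel η y w = ∑ A : Finset (Fin N),
      (1 - 2 * η) ^ A.card * η ^ (N - A.card) * (if (∀ i ∈ A, y i = w i) then 1 else 0) := by
  unfold bscKernel
  have h : ∀ i, (if y i = w i then 1 - η else η) = (1 - 2 * η) * (if y i = w i then 1 else 0) + η := by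
    intro i; split_ifs <;> ring
  simp_rw [h]
  rw [Finset.prod_add, Finset.powerset_univ]
  refine Finset.sum_congr rfl fun A _ => ?_
  rw [Finset.prod_mul_distrib, Finset.prod_const, Finset.prod_boole, Finset.prod_const,
    Finset.card_univ_sdiff, Fintype.card_fin]
  ring_nf

/-- Record (A) holds. [cite: RajakumarWatsonLiu2025, Lemma 3] -/
theorem erasureMixture_holds : ErasureMixture := fun η y w => bscKernel_eq_sum η y w

/-- Record (A′), proved from (A) by exchanging the two finite sums. [cite: RajakumarWatsonLiu2025, Lemma 3 and Lemma 4] -/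
theorem noisyIsErasureMixture_holds : NoisyIsErasureMixture := by
  intro N D η z w
  unfold noisyIqpProb marginalOn
  simp_rw [bscKernel_eq_sum, Finset.mul_sum]
  rw [Finset.sum_comm]
  refine Finset.sum_congr rfl fun A _ => ?_
  refine Finset.sum_congr rfl fun y _ => ?_
  split_ifs <;> ring

/-! ## §2 Pinning: marginals of IQP distributions are averages of pinned IQP distributions -/

section PinningTools

open Literature.Computability.Complexity.LowDegree (walsh_eq_prod_ite)
open Literature.Barriers.QuantumAdvantage (iqpProb_eq_sum walsh_mul_walsh_eq_symmDiff walsh_supp_comm)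
open scoped ComplexConjugate

/-- The agreement indicator `[w' =_A w]` as a product of per-coordinate indicators. [folklore] -/
private theorem ite_agree_eq_prod (A : Finset (Fin N)) (w' w : QReg N) :
    (if (∀ i ∈ A, w' i = w i) then (1 : ℝ) else 0) =
      ∏ i, (if (i ∈ A → w' i = w i) then (1 : ℝ) else 0) := by
  rw [Fintype.prod_boole]
  split_ifs <;> rfl

/-- PARTIAL CHARACTER SUM: a Walsh character summed over the strings agreeing with `w` on `A` (free off `A`)
is `[T ⊆ A] · 2^{N−|A|} · χ_T(w)` (the product trick). [cite: ODonnell2014, §1.4 (orthogonality of characters)] -/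
theorem sum_agree_walsh (A T : Finset (Fin N)) (w : QReg N) :
    (∑ w' : QReg N, if (∀ i ∈ A, w' i = w i) then walsh T w' else 0) =
      if T ⊆ A then (2 : ℝ) ^ (N - A.card) * walsh T w else 0 := by
  classical
  let F : Fin N → Bool → ℝ := fun i b =>
    (if (i ∈ A → b = w i) then (1 : ℝ) else 0) * (if i ∈ T then sgn b else 1)
  have hsum : ∀ w' : QReg N,
      (if (∀ i ∈ A, w' i = w i) then walsh T w' else 0) = ∏ i, F i (w' i) := by
    intro w'
    simp only [F]
    rw [Finset.prod_mul_distrib, ← walsh_eq_prod_ite, ← ite_agree_eq_prod]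
    split_ifs <;> simp
  simp_rw [hsum]
  rw [← Fintype.prod_sum F]
  have hcoord : ∀ i, (∑ b : Bool, F i b) =
      if i ∈ A then (if i ∈ T then sgn (w i) else 1) else (if i ∈ T then 0 else 2) := by
    intro i
    rw [Fintype.sum_bool]
    simp only [F]
    by_cases hA : i ∈ A <;> by_cases hT : i ∈ T <;> cases w i <;> simp [hA, hT] <;> norm_num
  simp_rw [hcoord]
  split_ifs with hTA
  · have hc : ∀ i, (if i ∈ A then (if i ∈ T then sgn (w i) else 1) else (if i ∈ T then (0 : ℝ) else 2)) =
        (if i ∈ T then sgn (w i) else 1) * (if i ∈ A then 1 else 2) := by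
      intro i
      by_cases hA : i ∈ A
      · simp [hA]
      · have hT : i ∉ T := fun h => hA (hTA h)
        simp [hA, hT]
    simp_rw [hc]
    rw [Finset.prod_mul_distrib, ← walsh_eq_prod_ite, Finset.prod_ite, Finset.prod_const_one, one_mul,
      Finset.prod_const]
    have hfilter : (Finset.univ.filter fun i : Fin N => ¬ i ∈ A) = Finset.univ \ A := by
      ext i; simp
    rw [hfilter, Finset.card_univ_sdiff, Fintype.card_fin, mul_comm]
  · obtain ⟨i, hiT, hiA⟩ := Finset.not_subset.mp hTA
    exact Finset.prod_eq_zero (Finset.mem_univ i) (by simp [hiA, hiT])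

/-- The same partial character sum, cast to `ℂ` with the indicator as a factor. [cite: ODonnell2014, §1.4] -/
private theorem sum_agree_walshC (A T : Finset (Fin N)) (w : QReg N) :
    (∑ w' : QReg N, (if (∀ i ∈ A, w' i = w i) then (1 : ℂ) else 0) * ((walsh T w' : ℝ) : ℂ)) =
      if T ⊆ A then (2 : ℂ) ^ (N - A.card) * ((walsh T w : ℝ) : ℂ) else 0 := by
  have h := sum_agree_walsh A T w
  rw [← Complex.ofReal_inj, Complex.ofReal_sum] at h
  convert h using 1
  · refine Finset.sum_congr rfl fun w' _ => ?_
    split_ifs <;> simp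
  · split_ifs <;> simp

/-- Membership in the support of a string. [folklore] -/
private theorem mem_supp_iff' (x : QReg N) (i : Fin N) : i ∈ supp x ↔ x i = true := by
  simp [Literature.Barriers.QuantumAdvantage.supp]

/-- `supp y ∆ supp y' ⊆ A` iff `y` and `y'` agree off `A`. [folklore] -/
private theorem symmDiff_supp_subset_iff (A : Finset (Fin N)) (y y' : QReg N) :
    symmDiff (supp y) (supp y') ⊆ A ↔ ∀ i, i ∉ A → y i = y' i := by
  constructor
  · intro h i hi
    by_contra hne
    refine hi (h ?_)
    rw [Finset.mem_symmDiff, mem_supp_iff', mem_supp_iff']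
    cases hy : y i <;> cases hy' : y' i <;> simp_all
  · intro h i hi
    by_contra hiA
    have e := h i hiA
    rw [Finset.mem_symmDiff, mem_supp_iff', mem_supp_iff', e] at hi
    tauto

/-- The sum over pinnings `b` (normalised to `false` on `A`) compatible with both `y` and `y'` is the indicator
that `y, y'` agree off `A`. [folklore] -/
private theorem sum_pin_indicator (A : Finset (Fin N)) (y y' : QReg N) :
    (∑ b : QReg N, if ((∀ i ∈ A, b i = false) ∧ (∀ i, i ∉ A → y i = b i) ∧
        (∀ i, i ∉ A → y' i = b i)) then (1 : ℂ) else 0) =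
      if (∀ i, i ∉ A → y i = y' i) then 1 else 0 := by
  classical
  split_ifs with hyy
  · set b₀ : QReg N := fun i => if i ∈ A then false else y i with hb₀
    have hiff : ∀ b : QReg N, ((∀ i ∈ A, b i = false) ∧ (∀ i, i ∉ A → y i = b i) ∧
        (∀ i, i ∉ A → y' i = b i)) ↔ b = b₀ := by
      intro b
      constructor
      · rintro ⟨h1, h2, -⟩
        rw [hb₀]
        funext i
        by_cases hi : i ∈ A
        · simp [hi, h1 i hi]
        · simp [hi, h2 i hi]
      · rintro rfl
        refine ⟨fun i hi => ?_, fun i hi => ?_, fun i hi => ?_⟩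
        · simp [hb₀, hi]
        · simp [hb₀, hi]
        · simp [hb₀, hi, hyy i hi]
    simp_rw [hiff]
    simp
  · refine Finset.sum_eq_zero fun b _ => ?_
    rw [if_neg]
    rintro ⟨-, h2, h3⟩
    exact hyy fun i hi => (h2 i hi).trans (h3 i hi).symm

/-- The pinned amplitude: Walsh sum over the strings `y` that agree with the pinned values `b` OFF `A`
(`g_z(y) = f(y)·χ_{supp z}(y)` is the tree's `twistedPhase`) — the amplitude of the circuit with the closed
qubits replaced by the computational-basis pins `b`. [cite: RajakumarWatsonLiu2025, Lemma 5 eq. (3)] -/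
def pinnedAmp (D : QCircuit iqpDiag N) (A : Finset (Fin N)) (b z w : QReg N) : ℂ :=
  ∑ y : QReg N, if (∀ i, i ∉ A → y i = b i) then ((walsh (supp w) y : ℝ) : ℂ) * twistedPhase D z y else 0

/-- The pinned IQP distribution on the open wires `A` (closed wires pinned to `b`); a probability vector in
`w|_A` (Parseval), equal to `iqpProb D z w` at `A = univ` (`iqpAmplitude_eq`).
[cite: RajakumarWatsonLiu2025, Lemma 5 eq. (3) and Lemma 4] -/
def pinnedProb (D : QCircuit iqpDiag N) (A : Finset (Fin N)) (b z w : QReg N) : ℝ :=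
  ‖(((2 : ℂ) ^ A.card)⁻¹) * pinnedAmp D A b z w‖ ^ 2

/-- PINNING (RWL24 Lemma 5 at the level of output probabilities = Parseval on the closed sub-cube): the marginal
on `A` of the IQP output distribution is the uniform average, over the `2^{N−|A|}` pinned values `b` of the
closed wires, of the pinned IQP distributions. Route: `iqpProb_eq_sum` (double character sum), `sum_agree_walsh`
on the left; `|amplitude|² = Σ_y Σ_y'` and `sum_pin_indicator` on the right.
[cite: RajakumarWatsonLiu2025, Lemma 5 and Lemma 4] -/
theorem marginal_iqpProb_eq_avg_pinned (D : QCircuit iqpDiag N) (A : Finset (Fin N)) (z w : QReg N) :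
    (∑ y : QReg N, if (∀ i ∈ A, y i = w i) then iqpProb D z y else 0) =
      ((2 : ℝ) ^ (N - A.card))⁻¹ *
        ∑ b : QReg N, if (∀ i ∈ A, b i = false) then
          ‖(((2 : ℂ) ^ A.card)⁻¹) *
              ∑ y : QReg N, if (∀ i, i ∉ A → y i = b i) then
                ((walsh (supp w) y : ℝ) : ℂ) * twistedPhase D z y else 0‖ ^ 2
        else 0 := by
  classical
  set CF : ℂ := ∑ x : QReg N, ∑ x' : QReg N,
      (if (∀ i, i ∉ A → x i = x' i) then
        ((walsh (supp w) x : ℝ) : ℂ) * ((walsh (supp w) x' : ℝ) : ℂ) *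
          (twistedPhase D z x * conj (twistedPhase D z x')) else 0) with hCF
  have hAN : A.card ≤ N := by simpa using Finset.card_le_univ A
  apply Complex.ofReal_injective
  -- ===== left-hand side: double character sum, inner sum over the strings agreeing on `A` =====
  have hL : (((∑ y : QReg N, if (∀ i ∈ A, y i = w i) then iqpProb D z y else 0 : ℝ)) : ℂ) =
      ((2 : ℂ) ^ N)⁻¹ * ((2 : ℂ) ^ N)⁻¹ * (2 : ℂ) ^ (N - A.card) * CF := by
    rw [Complex.ofReal_sum]
    have e1 : ∀ y : QReg N, (((if (∀ i ∈ A, y i = w i) then iqpProb D z y else 0 : ℝ)) : ℂ) =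
        (if (∀ i ∈ A, y i = w i) then (1 : ℂ) else 0) *
          (((2 : ℂ) ^ N)⁻¹ * ((2 : ℂ) ^ N)⁻¹ *
            ∑ x : QReg N, ∑ x' : QReg N, ((walsh (symmDiff (supp x) (supp x')) y : ℝ) : ℂ) *
              (twistedPhase D z x * conj (twistedPhase D z x'))) := by
      intro y
      rw [← iqpProb_eq_sum]
      split_ifs <;> simp
    simp_rw [e1]
    have e2 : (∑ y : QReg N, (if (∀ i ∈ A, y i = w i) then (1 : ℂ) else 0) *
          (((2 : ℂ) ^ N)⁻¹ * ((2 : ℂ) ^ N)⁻¹ *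
            ∑ x : QReg N, ∑ x' : QReg N, ((walsh (symmDiff (supp x) (supp x')) y : ℝ) : ℂ) *
              (twistedPhase D z x * conj (twistedPhase D z x')))) =
        ∑ x : QReg N, ∑ x' : QReg N, ((2 : ℂ) ^ N)⁻¹ * ((2 : ℂ) ^ N)⁻¹ *
          (twistedPhase D z x * conj (twistedPhase D z x')) *
          ∑ y : QReg N, (if (∀ i ∈ A, y i = w i) then (1 : ℂ) else 0) *
            ((walsh (symmDiff (supp x) (supp x')) y : ℝ) : ℂ) := by
      simp_rw [Finset.mul_sum]
      rw [Finset.sum_comm]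
      refine Finset.sum_congr rfl fun x _ => ?_
      rw [Finset.sum_comm]
      refine Finset.sum_congr rfl fun x' _ => Finset.sum_congr rfl fun y _ => ?_
      ring
    rw [e2]
    have e3 : ∀ x x' : QReg N, (∑ y : QReg N, (if (∀ i ∈ A, y i = w i) then (1 : ℂ) else 0) *
          ((walsh (symmDiff (supp x) (supp x')) y : ℝ) : ℂ)) =
        if (∀ i, i ∉ A → x i = x' i) then
          (2 : ℂ) ^ (N - A.card) * (((walsh (supp w) x : ℝ) : ℂ) * ((walsh (supp w) x' : ℝ) : ℂ))
        else 0 := by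
      intro x x'
      rw [sum_agree_walshC, ← walsh_mul_walsh_eq_symmDiff, walsh_supp_comm x w, walsh_supp_comm x' w]
      simp only [symmDiff_supp_subset_iff]
      split_ifs
      · push_cast; ring
      · rfl
    simp_rw [e3]
    rw [hCF, Finset.mul_sum]
    refine Finset.sum_congr rfl fun x _ => ?_
    rw [Finset.mul_sum]
    refine Finset.sum_congr rfl fun x' _ => ?_
    split_ifs <;> ring
  -- ===== right-hand side: |pinned amplitude|² expanded, the pinning sum collapses =====
  have hR : ((((2 : ℝ) ^ (N - A.card))⁻¹ *
        ∑ b : QReg N, if (∀ i ∈ A, b i = false) then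
          ‖(((2 : ℂ) ^ A.card)⁻¹) *
              ∑ y : QReg N, if (∀ i, i ∉ A → y i = b i) then
                ((walsh (supp w) y : ℝ) : ℂ) * twistedPhase D z y else 0‖ ^ 2
        else 0 : ℝ) : ℂ) =
      ((2 : ℂ) ^ (N - A.card))⁻¹ * (((2 : ℂ) ^ A.card)⁻¹ * ((2 : ℂ) ^ A.card)⁻¹) * CF := by
    have e4 : ∀ b : QReg N, (((if (∀ i ∈ A, b i = false) then
          ‖(((2 : ℂ) ^ A.card)⁻¹) *
              ∑ y : QReg N, if (∀ i, i ∉ A → y i = b i) then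
                ((walsh (supp w) y : ℝ) : ℂ) * twistedPhase D z y else 0‖ ^ 2
        else 0 : ℝ)) : ℂ) =
        (if (∀ i ∈ A, b i = false) then (1 : ℂ) else 0) *
          ((((2 : ℂ) ^ A.card)⁻¹ * ((2 : ℂ) ^ A.card)⁻¹) *
            ∑ y : QReg N, ∑ y' : QReg N,
              (if ((∀ i, i ∉ A → y i = b i) ∧ (∀ i, i ∉ A → y' i = b i)) then
                ((walsh (supp w) y : ℝ) : ℂ) * ((walsh (supp w) y' : ℝ) : ℂ) *
                  (twistedPhase D z y * conj (twistedPhase D z y')) else 0)) := by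
      intro b
      split_ifs with hb
      · rw [one_mul, ← Complex.normSq_eq_norm_sq, ← Complex.mul_conj, map_mul, map_inv₀, map_pow,
          Complex.conj_ofNat, map_sum]
        have ec : ∀ y' : QReg N, conj (if (∀ i, i ∉ A → y' i = b i) then
            ((walsh (supp w) y' : ℝ) : ℂ) * twistedPhase D z y' else 0) =
            (if (∀ i, i ∉ A → y' i = b i) then
              ((walsh (supp w) y' : ℝ) : ℂ) * conj (twistedPhase D z y') else 0) := by
          intro y'
          split_ifs <;> simp [Complex.conj_ofReal]
        simp_rw [ec]
        rw [show ∀ (c S S' : ℂ), c * S * (c * S') = c * c * (S * S') from fun c S S' => by ring,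
          Finset.sum_mul_sum]
        congr 1
        refine Finset.sum_congr rfl fun y _ => Finset.sum_congr rfl fun y' _ => ?_
        by_cases h1 : (∀ i, i ∉ A → y i = b i)
        · by_cases h2 : (∀ i, i ∉ A → y' i = b i)
          · rw [if_pos h1, if_pos h2, if_pos ⟨h1, h2⟩]; ring
          · rw [if_neg h2, if_neg (show ¬((∀ i, i ∉ A → y i = b i) ∧ (∀ i, i ∉ A → y' i = b i)) from
              fun h => h2 h.2), mul_zero]
        · rw [if_neg h1, if_neg (show ¬((∀ i, i ∉ A → y i = b i) ∧ (∀ i, i ∉ A → y' i = b i)) from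
            fun h => h1 h.1), zero_mul]
      · simp
    rw [Complex.ofReal_mul, Complex.ofReal_inv, Complex.ofReal_pow, Complex.ofReal_ofNat,
      Complex.ofReal_sum]
    simp_rw [e4]
    have e5 : (∑ b : QReg N, (if (∀ i ∈ A, b i = false) then (1 : ℂ) else 0) *
          ((((2 : ℂ) ^ A.card)⁻¹ * ((2 : ℂ) ^ A.card)⁻¹) *
            ∑ y : QReg N, ∑ y' : QReg N,
              (if ((∀ i, i ∉ A → y i = b i) ∧ (∀ i, i ∉ A → y' i = b i)) then
                ((walsh (supp w) y : ℝ) : ℂ) * ((walsh (supp w) y' : ℝ) : ℂ) *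
                  (twistedPhase D z y * conj (twistedPhase D z y')) else 0))) =
        (((2 : ℂ) ^ A.card)⁻¹ * ((2 : ℂ) ^ A.card)⁻¹) *
          ∑ y : QReg N, ∑ y' : QReg N,
            ((walsh (supp w) y : ℝ) : ℂ) * ((walsh (supp w) y' : ℝ) : ℂ) *
              (twistedPhase D z y * conj (twistedPhase D z y')) *
            ∑ b : QReg N, (if ((∀ i ∈ A, b i = false) ∧ (∀ i, i ∉ A → y i = b i) ∧
                (∀ i, i ∉ A → y' i = b i)) then (1 : ℂ) else 0) := by
      simp_rw [Finset.mul_sum]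
      rw [Finset.sum_comm]
      refine Finset.sum_congr rfl fun y _ => ?_
      rw [Finset.sum_comm]
      refine Finset.sum_congr rfl fun y' _ => Finset.sum_congr rfl fun b _ => ?_
      by_cases hb : (∀ i ∈ A, b i = false)
      · by_cases h12 : ((∀ i, i ∉ A → y i = b i) ∧ (∀ i, i ∉ A → y' i = b i))
        · rw [if_pos hb, if_pos h12, if_pos ⟨hb, h12⟩]; ring
        · rw [if_pos hb, if_neg h12, if_neg (show ¬((∀ i ∈ A, b i = false) ∧ (∀ i, i ∉ A → y i = b i) ∧
            (∀ i, i ∉ A → y' i = b i)) from fun h => h12 h.2)]; ring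
      · rw [if_neg hb, if_neg (show ¬((∀ i ∈ A, b i = false) ∧ (∀ i, i ∉ A → y i = b i) ∧
          (∀ i, i ∉ A → y' i = b i)) from fun h => hb h.1)]; simp
    rw [e5, ← mul_assoc, hCF]
    congr 1
    refine Finset.sum_congr rfl fun y _ => Finset.sum_congr rfl fun y' _ => ?_
    rw [sum_pin_indicator]
    split_ifs <;> simp
  rw [hL, hR]
  congr 1
  have h2N : (2 : ℂ) ^ N = 2 ^ (N - A.card) * 2 ^ A.card := by
    rw [← pow_add, Nat.sub_add_cancel hAN]
  rw [h2N]
  field_simp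

/-- Record (B) PINNING IDENTITY: `marginalOn A (iqpProb D z) = 2^{−(N−|A|)} Σ_{b|_A = 0} pinnedProb D A b z`.
[cite: RajakumarWatsonLiu2025, Lemma 5 and Lemma 4] -/
def PinningIdentity : Prop :=
  ∀ {N : ℕ} (D : QCircuit iqpDiag N) (A : Finset (Fin N)) (z w : QReg N),
    marginalOn A (iqpProb D z) w =
      ((2 : ℝ) ^ (N - A.card))⁻¹ * ∑ b : QReg N, if (∀ i ∈ A, b i = false) then pinnedProb D A b z w else 0

/-- Record (B), proved. [cite: RajakumarWatsonLiu2025, Lemma 5 and Lemma 4] -/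
theorem pinningIdentity_holds : PinningIdentity :=
  fun D A z w => marginal_iqpProb_eq_avg_pinned D A z w

end PinningTools

/-! ## §3 Factorisation over the interaction graph -/

/-- A gate of `D` straddles `A₁, A₂` if it touches both. [cite: RajakumarWatsonLiu2025, §3.1.1 (interaction graph `G_C(V,E)`)] -/
def Straddles (D : QCircuit iqpDiag N) (A₁ A₂ : Finset (Fin N)) : Prop :=
  ∃ g ∈ D.gates, (g.wires ∩ A₁).Nonempty ∧ (g.wires ∩ A₂).Nonempty

/-- The interaction graph of `D`: wires `i ≠ j` are adjacent iff some gate touches both ("vertices correspond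
to qubits and edges correspond to entangling gates"). For `{Z, CZ, T}` its maximum degree is at most the number
of `CZ` gates on a wire. [cite: RajakumarWatsonLiu2025, §3.1.1 and proof of Corollary 19] -/
def intGraph (D : QCircuit iqpDiag N) : SimpleGraph (Fin N) :=
  SimpleGraph.fromRel fun i j => ∃ g ∈ D.gates, i ∈ g.wires ∧ j ∈ g.wires

/-- Record (C) COMPONENT FACTORISATION: pinned distributions multiply across open parts that no gate straddles
(in particular across connected components of the open part of `intGraph D`) — the closed, pinned qubits'
"edges … are essentially removed" and the components are simulated independently and exactly.
[cite: RajakumarWatsonLiu2025, §3.1.1 (after Lemma 5) and Lemma 8] -/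
def ComponentFactorisation : Prop :=
  ∀ {N : ℕ} (D : QCircuit iqpDiag N) (A₁ A₂ : Finset (Fin N)), Disjoint A₁ A₂ → ¬ Straddles D A₁ A₂ →
    ∀ b z w : QReg N, pinnedProb D (A₁ ∪ A₂) b z w = pinnedProb D A₁ b z w * pinnedProb D A₂ b z w

/-- (S3) `¬ Straddles` from the graph: parts of the open set with no `intGraph` edge between them.
[cite: RajakumarWatsonLiu2025, §3.1.1] -/
def NoEdgeNoStraddle : Prop :=
  ∀ {N : ℕ} (D : QCircuit iqpDiag N) (A₁ A₂ : Finset (Fin N)), Disjoint A₁ A₂ →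
    (∀ i ∈ A₁, ∀ j ∈ A₂, ¬ (intGraph D).Adj i j) → ¬ Straddles D A₁ A₂

/-- (S3), proved. [cite: RajakumarWatsonLiu2025, §3.1.1] -/
theorem noEdgeNoStraddle_holds : NoEdgeNoStraddle := by
  intro N D A₁ A₂ hdis hno
  rintro ⟨g, hg, ⟨i, hi⟩, ⟨j, hj⟩⟩
  rw [Finset.mem_inter] at hi hj
  have hne : i ≠ j := by
    rintro rfl
    exact Finset.disjoint_left.mp hdis hi.2 hj.2
  refine hno i hi.2 j hj.2 ?_
  rw [intGraph, SimpleGraph.fromRel_adj]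
  exact ⟨hne, Or.inl ⟨g, hg, hi.1, hj.1⟩⟩

/-! ### Factorisation: proof of record (C) (gate locality + a bijection of pinned strings) -/

section FactorisationProof

open Literature.Barriers.QuantumAdvantage (gatePhase norm_twistedPhase)

/-- Overwrite the `A`-coordinates of `y` by those of `b`. [folklore] -/
def cutOff (A : Finset (Fin N)) (b y : QReg N) : QReg N := fun i => if i ∈ A then b i else y i

/-- Gate phases only read the gate's wires (locality of the diagonal gates).
[cite: RajakumarWatsonLiu2025, Lemma 5 (proof, Appendix A)] -/
theorem gatePhase_congr (g : QGate iqpDiag N) {y y' : QReg N} (h : ∀ i ∈ g.wires, y i = y' i) :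
    gatePhase g y = gatePhase g y' := by
  cases g with
  | gate g e =>
    have he : y ∘ e = y' ∘ e := funext fun j => h (e j) (by simp [QGate.wires])
    show iqpDiag.mat g (y ∘ e) (y ∘ e) = iqpDiag.mat g (y' ∘ e) (y' ∘ e)
    rw [he]
  | oracle k e => rfl

/-- The four-term identity for ONE gate that does not straddle `A₁, A₂`.
[cite: RajakumarWatsonLiu2025, §3.1.1 (after Lemma 5)] -/
theorem gatePhase_mul_of_not_straddle (g : QGate iqpDiag N) {A₁ A₂ : Finset (Fin N)}
    (hg : ¬ ((g.wires ∩ A₁).Nonempty ∧ (g.wires ∩ A₂).Nonempty)) {b y : QReg N}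
    (hy : ∀ i, i ∉ A₁ ∪ A₂ → y i = b i) :
    gatePhase g y * gatePhase g b = gatePhase g (cutOff A₂ b y) * gatePhase g (cutOff A₁ b y) := by
  rw [not_and_or, Finset.not_nonempty_iff_eq_empty, Finset.not_nonempty_iff_eq_empty] at hg
  rcases hg with h1 | h2
  · have hA1 : ∀ i ∈ g.wires, i ∉ A₁ := fun i hi hA => by
      have := Finset.mem_inter.mpr ⟨hi, hA⟩; rw [h1] at this; simp at this
    have e2 : gatePhase g (cutOff A₁ b y) = gatePhase g y :=
      gatePhase_congr g fun i hi => by simp [cutOff, hA1 i hi]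
    have e1 : gatePhase g (cutOff A₂ b y) = gatePhase g b :=
      gatePhase_congr g fun i hi => by
        by_cases hA2 : i ∈ A₂
        · simp [cutOff, hA2]
        · simp [cutOff, hA2, hy i (by simp [hA1 i hi, hA2])]
    rw [e1, e2, mul_comm]
  · have hA2 : ∀ i ∈ g.wires, i ∉ A₂ := fun i hi hA => by
      have := Finset.mem_inter.mpr ⟨hi, hA⟩; rw [h2] at this; simp at this
    have e1 : gatePhase g (cutOff A₂ b y) = gatePhase g y :=
      gatePhase_congr g fun i hi => by simp [cutOff, hA2 i hi]
    have e2 : gatePhase g (cutOff A₁ b y) = gatePhase g b :=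
      gatePhase_congr g fun i hi => by
        by_cases hA1 : i ∈ A₁
        · simp [cutOff, hA1]
        · simp [cutOff, hA1, hy i (by simp [hA1, hA2 i hi])]
    rw [e1, e2]

/-- The four-term identity for the whole phase function when no gate straddles.
[cite: RajakumarWatsonLiu2025, §3.1.1 (after Lemma 5)] -/
theorem circPhase_mul_of_not_straddles (D : QCircuit iqpDiag N) {A₁ A₂ : Finset (Fin N)}
    (hD : ¬ Straddles D A₁ A₂) {b y : QReg N} (hy : ∀ i, i ∉ A₁ ∪ A₂ → y i = b i) :
    circPhase D y * circPhase D b = circPhase D (cutOff A₂ b y) * circPhase D (cutOff A₁ b y) := by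
  simp only [Literature.Barriers.QuantumAdvantage.circPhase]
  rw [← List.prod_map_mul, ← List.prod_map_mul]
  congr 1
  refine List.map_congr_left fun g hg => ?_
  have hg' : ¬ ((g.wires ∩ A₁).Nonempty ∧ (g.wires ∩ A₂).Nonempty) := fun h => hD ⟨g, hg, h⟩
  exact gatePhase_mul_of_not_straddle g hg' hy

/-- The same identity for Walsh characters (coordinatewise). [cite: ODonnell2014, §1.4] -/
theorem walsh_mul_cutOff (T : Finset (Fin N)) {A₁ A₂ : Finset (Fin N)} (hdis : Disjoint A₁ A₂)
    {b y : QReg N} (hy : ∀ i, i ∉ A₁ ∪ A₂ → y i = b i) :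
    walsh T y * walsh T b = walsh T (cutOff A₂ b y) * walsh T (cutOff A₁ b y) := by
  rw [walsh, walsh, walsh, walsh, ← Finset.prod_mul_distrib, ← Finset.prod_mul_distrib]
  refine Finset.prod_congr rfl fun i _ => ?_
  by_cases h1 : i ∈ A₁
  · have h2 : i ∉ A₂ := Finset.disjoint_left.mp hdis h1
    simp [cutOff, h1, h2]
  · by_cases h2 : i ∈ A₂
    · simp [cutOff, h1, h2, mul_comm]
    · simp [cutOff, h1, h2, hy i (by simp [h1, h2])]

/-- The four-term identity for the pinned summand `χ_{supp w}(y)·g_z(y)`.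
[cite: RajakumarWatsonLiu2025, §3.1.1 (after Lemma 5)] -/
theorem summand_mul_cutOff (D : QCircuit iqpDiag N) {A₁ A₂ : Finset (Fin N)} (hdis : Disjoint A₁ A₂)
    (hD : ¬ Straddles D A₁ A₂) (z w : QReg N) {b y : QReg N} (hy : ∀ i, i ∉ A₁ ∪ A₂ → y i = b i) :
    (((walsh (supp w) y : ℝ) : ℂ) * twistedPhase D z y) *
        (((walsh (supp w) b : ℝ) : ℂ) * twistedPhase D z b) =
      (((walsh (supp w) (cutOff A₂ b y) : ℝ) : ℂ) * twistedPhase D z (cutOff A₂ b y)) *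
        (((walsh (supp w) (cutOff A₁ b y) : ℝ) : ℂ) * twistedPhase D z (cutOff A₁ b y)) := by
  simp only [Literature.Barriers.QuantumAdvantage.twistedPhase]
  have h1 := walsh_mul_cutOff (supp w) hdis hy
  have h2 := walsh_mul_cutOff (supp z) hdis hy
  have h3 := circPhase_mul_of_not_straddles D hD hy
  calc (((walsh (supp w) y : ℝ) : ℂ) * (circPhase D y * ((walsh (supp z) y : ℝ) : ℂ))) *
        (((walsh (supp w) b : ℝ) : ℂ) * (circPhase D b * ((walsh (supp z) b : ℝ) : ℂ)))
      = (((walsh (supp w) y * walsh (supp w) b : ℝ)) : ℂ) * (circPhase D y * circPhase D b) *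
          (((walsh (supp z) y * walsh (supp z) b : ℝ)) : ℂ) := by push_cast; ring
    _ = (((walsh (supp w) (cutOff A₂ b y) * walsh (supp w) (cutOff A₁ b y) : ℝ)) : ℂ) *
          (circPhase D (cutOff A₂ b y) * circPhase D (cutOff A₁ b y)) *
          (((walsh (supp z) (cutOff A₂ b y) * walsh (supp z) (cutOff A₁ b y) : ℝ)) : ℂ) := by
        rw [h1, h2, h3]
    _ = _ := by push_cast; ring

/-- AMPLITUDE FACTORISATION: `amp(A₁ ∪ A₂) · (unimodular constant) = amp(A₁) · amp(A₂)` — the bijection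
`y ↦ (cutOff A₂ b y, cutOff A₁ b y)` between strings pinned off `A₁ ∪ A₂` and pairs of strings pinned off `A₁`,
off `A₂`. [cite: RajakumarWatsonLiu2025, §3.1.1 (after Lemma 5) and Lemma 8] -/
theorem pinnedAmp_union_mul (D : QCircuit iqpDiag N) {A₁ A₂ : Finset (Fin N)} (hdis : Disjoint A₁ A₂)
    (hD : ¬ Straddles D A₁ A₂) (b z w : QReg N) :
    pinnedAmp D (A₁ ∪ A₂) b z w * (((walsh (supp w) b : ℝ) : ℂ) * twistedPhase D z b) =
      pinnedAmp D A₁ b z w * pinnedAmp D A₂ b z w := by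
  classical
  unfold pinnedAmp
  rw [Finset.sum_mul, Finset.sum_mul_sum, ← Finset.sum_product']
  have eL : ∀ y : QReg N, (if (∀ i, i ∉ A₁ ∪ A₂ → y i = b i) then
        ((walsh (supp w) y : ℝ) : ℂ) * twistedPhase D z y else 0) *
        (((walsh (supp w) b : ℝ) : ℂ) * twistedPhase D z b) =
      if (∀ i, i ∉ A₁ ∪ A₂ → y i = b i) then
        (((walsh (supp w) y : ℝ) : ℂ) * twistedPhase D z y) *
          (((walsh (supp w) b : ℝ) : ℂ) * twistedPhase D z b) else 0 := by
    intro y; split_ifs <;> simp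
  have eR : ∀ p : QReg N × QReg N,
      (if (∀ i, i ∉ A₁ → p.1 i = b i) then ((walsh (supp w) p.1 : ℝ) : ℂ) * twistedPhase D z p.1 else 0) *
        (if (∀ i, i ∉ A₂ → p.2 i = b i) then ((walsh (supp w) p.2 : ℝ) : ℂ) * twistedPhase D z p.2
          else 0) =
      if ((∀ i, i ∉ A₁ → p.1 i = b i) ∧ (∀ i, i ∉ A₂ → p.2 i = b i)) then
        (((walsh (supp w) p.1 : ℝ) : ℂ) * twistedPhase D z p.1) *
          (((walsh (supp w) p.2 : ℝ) : ℂ) * twistedPhase D z p.2) else 0 := by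
    intro p
    by_cases h1 : (∀ i, i ∉ A₁ → p.1 i = b i)
    · by_cases h2 : (∀ i, i ∉ A₂ → p.2 i = b i)
      · rw [if_pos h1, if_pos h2, if_pos ⟨h1, h2⟩]
      · rw [if_neg h2, if_neg (show ¬((∀ i, i ∉ A₁ → p.1 i = b i) ∧ (∀ i, i ∉ A₂ → p.2 i = b i)) from
          fun h => h2 h.2), mul_zero]
    · rw [if_neg h1, if_neg (show ¬((∀ i, i ∉ A₁ → p.1 i = b i) ∧ (∀ i, i ∉ A₂ → p.2 i = b i)) from
        fun h => h1 h.1), zero_mul]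
  simp_rw [eL, eR]
  rw [← Finset.sum_filter, ← Finset.sum_filter]
  refine Finset.sum_nbij' (fun y => (cutOff A₂ b y, cutOff A₁ b y)) (fun p => cutOff A₁ p.1 p.2)
    ?_ ?_ ?_ ?_ ?_
  · intro y hy
    rw [Finset.mem_filter] at hy ⊢
    refine ⟨Finset.mem_product.mpr ⟨Finset.mem_univ _, Finset.mem_univ _⟩, fun i hi => ?_, fun i hi => ?_⟩
    · by_cases h2 : i ∈ A₂
      · simp [cutOff, h2]
      · simp [cutOff, h2, hy.2 i (by simp [hi, h2])]
    · by_cases h1 : i ∈ A₁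
      · simp [cutOff, h1]
      · simp [cutOff, h1, hy.2 i (by simp [hi, h1])]
  · intro p hp
    rw [Finset.mem_filter] at hp ⊢
    refine ⟨Finset.mem_univ _, fun i hi => ?_⟩
    simp only [Finset.mem_union, not_or] at hi
    simp [cutOff, hi.1, hp.2.2 i hi.2]
  · intro y _
    funext i
    by_cases h1 : i ∈ A₁
    · have h2 : i ∉ A₂ := Finset.disjoint_left.mp hdis h1
      simp [cutOff, h1, h2]
    · simp [cutOff, h1]
  · intro p hp
    rw [Finset.mem_filter] at hp
    obtain ⟨-, hp1, hp2⟩ := hp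
    refine Prod.ext ?_ ?_ <;> funext i
    · by_cases h2 : i ∈ A₂
      · have h1 : i ∉ A₁ := fun h => Finset.disjoint_left.mp hdis h h2
        simp [cutOff, h2, hp1 i h1]
      · by_cases h1 : i ∈ A₁
        · simp [cutOff, h2, h1]
        · simp [cutOff, h2, h1, hp1 i h1, hp2 i h2]
    · by_cases h1 : i ∈ A₁
      · have h2 : i ∉ A₂ := Finset.disjoint_left.mp hdis h1
        simp [cutOff, h1, hp2 i h2]
      · simp [cutOff, h1]
  · intro y hy
    rw [Finset.mem_filter] at hy
    exact summand_mul_cutOff D hdis hD z w hy.2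

/-- `χ_T(x)² = 1`. [folklore] -/
private theorem walsh_mul_self' (T : Finset (Fin N)) (x : QReg N) : walsh T x * walsh T x = 1 := by
  rw [walsh, ← Finset.prod_mul_distrib]
  simp

/-- The pinned summand is unimodular. [folklore] -/
private theorem norm_walsh_twisted (D : QCircuit iqpDiag N) (z w b : QReg N) :
    ‖((walsh (supp w) b : ℝ) : ℂ) * twistedPhase D z b‖ = 1 := by
  rw [norm_mul, norm_twistedPhase, mul_one, Complex.norm_real, Real.norm_eq_abs]
  rcases mul_self_eq_one_iff.mp (walsh_mul_self' (supp w) b) with h | h <;> simp [h]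

/-- Record (C), proved. [cite: RajakumarWatsonLiu2025, §3.1.1 (after Lemma 5) and Lemma 8] -/
theorem componentFactorisation_holds : ComponentFactorisation := by
  intro N D A₁ A₂ hdis hD b z w
  unfold pinnedProb
  have hamp := congrArg Norm.norm (pinnedAmp_union_mul D hdis hD b z w)
  rw [norm_mul, norm_walsh_twisted, mul_one, norm_mul] at hamp
  rw [Finset.card_union_of_disjoint hdis, pow_add, mul_inv]
  simp only [norm_mul]
  rw [hamp]
  ring

end FactorisationProof

/-! ## §4 Dictionary: interspersed dephasing on a commuting circuit = output bit flips -/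

/-- `Z` on wire `j` as a diagonal `±1` matrix on the register. [cite: NielsenChuang2010, §8.3.6 (phase flip / phase damping)] -/
def zOn (j : Fin N) : Matrix (QReg N) (QReg N) ℂ := Matrix.diagonal fun x => if x j then -1 else 1

/-- The dephasing channel of rate `η` on wire `j`: `ρ ↦ (1−η)ρ + η Z_j ρ Z_j`.
[cite: NielsenChuang2010, §8.3.6 (phase flip channel)] -/
def dephase (η : ℝ) (j : Fin N) (ρ : Matrix (QReg N) (QReg N) ℂ) : Matrix (QReg N) (QReg N) ℂ :=
  ((1 - η : ℝ) : ℂ) • ρ + ((η : ℝ) : ℂ) • (zOn j * ρ * zOn j)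

/-- Record (E1): dephasing commutes with conjugation by any diagonal operator (all IQP layers), so interspersed
dephasing can be commuted to the end of a commuting circuit. [cite: RajakumarWatsonLiu2025, §5.1 (proof of Theorem 13)] -/
def DephaseCommutesDiagonal : Prop :=
  ∀ {N : ℕ} (η : ℝ) (j : Fin N) (d : QReg N → ℂ) (ρ : Matrix (QReg N) (QReg N) ℂ),
    dephase η j (Matrix.diagonal d * ρ * (Matrix.diagonal d)ᴴ) =
      Matrix.diagonal d * dephase η j ρ * (Matrix.diagonal d)ᴴ

/-- Record (E2): dephasings on one wire compose multiplicatively in `1 − 2η`: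
`(1 − 2η″) = (1 − 2η)(1 − 2η′)`, i.e. `η″ = η + η′ − 2ηη′`; hence `d` slots of rate `p` give
`1 − 2η_d = (1−2p)^d`. [cite: RajakumarWatsonLiu2025, §5.1 (proof of Theorem 13: `p_X` from `(1−2p)^d`)] -/
def DephaseCompose : Prop :=
  ∀ {N : ℕ} (η η' : ℝ) (j : Fin N) (ρ : Matrix (QReg N) (QReg N) ℂ),
    dephase η j (dephase η' j ρ) = dephase (η + η' - 2 * η * η') j ρ

/-- `Z_j² = 1`. [cite: NielsenChuang2010, §2.1.3 (Pauli matrices)] -/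
theorem zOn_mul_zOn (j : Fin N) : zOn j * zOn j = (1 : Matrix (QReg N) (QReg N) ℂ) := by
  rw [zOn, Matrix.diagonal_mul_diagonal, ← Matrix.diagonal_one]
  congr 1; funext x; split_ifs <;> norm_num

/-- Record (E1), proved: diagonal operators commute with `Z_j`. [cite: RajakumarWatsonLiu2025, §5.1 (proof of Theorem 13)] -/
theorem dephaseCommutesDiagonal_holds : DephaseCommutesDiagonal := by
  intro N η j d ρ
  have hc1 : zOn j * Matrix.diagonal d = Matrix.diagonal d * zOn j := by
    rw [zOn, Matrix.diagonal_mul_diagonal, Matrix.diagonal_mul_diagonal]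
    congr 1; funext x; exact mul_comm _ _
  have hc2 : (Matrix.diagonal d)ᴴ * zOn j = zOn j * (Matrix.diagonal d)ᴴ := by
    rw [Matrix.diagonal_conjTranspose, zOn, Matrix.diagonal_mul_diagonal, Matrix.diagonal_mul_diagonal]
    congr 1; funext x; exact mul_comm _ _
  have key : zOn j * (Matrix.diagonal d * ρ * (Matrix.diagonal d)ᴴ) * zOn j =
      Matrix.diagonal d * (zOn j * ρ * zOn j) * (Matrix.diagonal d)ᴴ := by
    calc zOn j * (Matrix.diagonal d * ρ * (Matrix.diagonal d)ᴴ) * zOn j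
        = (zOn j * Matrix.diagonal d) * ρ * ((Matrix.diagonal d)ᴴ * zOn j) := by
          simp only [Matrix.mul_assoc]
      _ = (Matrix.diagonal d * zOn j) * ρ * (zOn j * (Matrix.diagonal d)ᴴ) := by rw [hc1, hc2]
      _ = Matrix.diagonal d * (zOn j * ρ * zOn j) * (Matrix.diagonal d)ᴴ := by
          simp only [Matrix.mul_assoc]
  unfold dephase
  rw [Matrix.mul_add, Matrix.add_mul, Matrix.mul_smul, Matrix.smul_mul, Matrix.mul_smul, Matrix.smul_mul, key]

/-- Record (E2), proved: `Z_j² = 1` and coefficient bookkeeping. [cite: RajakumarWatsonLiu2025, §5.1 (proof of Theorem 13)] -/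
theorem dephaseCompose_holds : DephaseCompose := by
  intro N η η' j ρ
  have h2 : zOn j * (zOn j * ρ * zOn j) * zOn j = ρ := by
    rw [show zOn j * (zOn j * ρ * zOn j) * zOn j = (zOn j * zOn j) * ρ * (zOn j * zOn j) by
      simp only [Matrix.mul_assoc], zOn_mul_zOn, Matrix.one_mul, Matrix.mul_one]
  unfold dephase
  simp only [Matrix.mul_add, Matrix.add_mul, Matrix.mul_smul, Matrix.smul_mul, h2]
  push_cast
  module

/-- Diagonal (Born) weight of an operator at the basis string `w`. [cite: NielsenChuang2010, §2.2.5 (measurement in the computational basis)] -/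
def bornDiag (M : Matrix (QReg N) (QReg N) ℂ) (w : QReg N) : ℝ := (M w w).re

/-- Record (E3): a dephasing just before the final Hadamard layer is a flip of the measured bit
(`H^{⊗N} Z_j H^{⊗N} = X_j`): Born weights after `H·𝒵_{η,j}(σ)·H` are the `η`-mixture of those of `HσH` at `w`
and at `w` with bit `j` flipped (`flipAt`, the tree's). With E1–E2: `d` interspersed dephasing layers of rate
`p` on `H·D·H|z⟩` give exactly the `bscKernel η_d`-smoothed `iqpProb`, `1 − 2η_d = (1 − 2p)^d`.
[cite: RajakumarWatsonLiu2025, §5.1 (proof of Theorem 13: "these dephasing channels commute through the circuit and become bit-flip errors on the output")] -/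
def DephaseIsOutputBitflip : Prop :=
  ∀ {N : ℕ} (η : ℝ) (j : Fin N) (σ : Matrix (QReg N) (QReg N) ℂ) (w : QReg N),
    bornDiag (hGateAll N * dephase η j σ * hGateAll N) w =
      (1 - η) * bornDiag (hGateAll N * σ * hGateAll N) w + η * bornDiag (hGateAll N * σ * hGateAll N) (flipAt j w)

/-- Flipping bit `j` of `w` multiplies the Walsh character `χ_{supp w}` by `sgn (x j)`. [cite: ODonnell2014, §1.4] -/
theorem walsh_supp_flipAt (j : Fin N) (w x : QReg N) :
    walsh (supp (flipAt j w)) x = sgn (x j) * walsh (supp w) x := by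
  rw [Literature.Barriers.QuantumAdvantage.walsh_supp_comm,
    Literature.Barriers.QuantumAdvantage.walsh_supp_comm w x]
  unfold walsh
  by_cases hj : j ∈ supp x
  · rw [← Finset.mul_prod_erase _ _ hj, ← Finset.mul_prod_erase _ _ hj, ← mul_assoc]
    have hxj : x j = true := by simpa [Literature.Barriers.QuantumAdvantage.supp] using hj
    congr 1
    · rw [Literature.Barriers.QuantumAdvantage.flipAt, Function.update_self, hxj]
      cases w j <;> simp [sgn]
    · refine Finset.prod_congr rfl fun i hi => ?_
      rw [Literature.Barriers.QuantumAdvantage.flipAt, Function.update_of_ne (Finset.ne_of_mem_erase hi)]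
  · have hxj : x j = false := by simpa [Literature.Barriers.QuantumAdvantage.supp] using hj
    rw [hxj, show sgn false = 1 from rfl, one_mul]
    refine Finset.prod_congr rfl fun i hi => ?_
    rw [Literature.Barriers.QuantumAdvantage.flipAt, Function.update_of_ne (ne_of_mem_of_not_mem hi hj)]

/-- `H^{⊗N} Z_j (·) Z_j H^{⊗N}` has the Born diagonal of `H^{⊗N} (·) H^{⊗N}` read at the flipped string
(`H Z H = X`). [cite: NielsenChuang2010, §4.2 (HZH = X, Exercise 4.13)] -/
theorem hGateAll_conj_zOn_apply (j : Fin N) (σ : Matrix (QReg N) (QReg N) ℂ) (w : QReg N) :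
    (hGateAll N * (zOn j * σ * zOn j) * hGateAll N) w w =
      (hGateAll N * σ * hGateAll N) (flipAt j w) (flipAt j w) := by
  have hz : ∀ x : QReg N, (((sgn (x j) : ℝ)) : ℂ) = (if x j then -1 else 1) := by
    intro x; unfold sgn; split_ifs <;> simp
  have key1 : ∀ x, hGateAll N (flipAt j w) x = hGateAll N w x * (if x j then -1 else 1) := by
    intro x
    rw [Literature.Barriers.QuantumAdvantage.hGateAll_apply_eq,
      Literature.Barriers.QuantumAdvantage.hGateAll_apply_eq, walsh_supp_flipAt, ← hz]
    push_cast; ring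
  have key2 : ∀ y, hGateAll N y (flipAt j w) = (if y j then -1 else 1) * hGateAll N y w := by
    intro y
    rw [Literature.Barriers.QuantumAdvantage.hGateAll_apply_eq,
      Literature.Barriers.QuantumAdvantage.hGateAll_apply_eq,
      Literature.Barriers.QuantumAdvantage.walsh_supp_comm y (flipAt j w), walsh_supp_flipAt,
      Literature.Barriers.QuantumAdvantage.walsh_supp_comm w y, ← hz]
    push_cast; ring
  rw [Matrix.mul_apply, Matrix.mul_apply]
  refine Finset.sum_congr rfl fun y _ => ?_
  rw [Matrix.mul_apply, Matrix.mul_apply, Finset.sum_mul, Finset.sum_mul]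
  refine Finset.sum_congr rfl fun x _ => ?_
  have hZ : (zOn j * σ * zOn j) x y = (if x j then -1 else 1) * σ x y * (if y j then -1 else 1) := by
    simp [zOn, Matrix.mul_diagonal, Matrix.diagonal_mul]
  rw [hZ, key1 x, key2 y]
  ring

/-- Record (E3), proved: linearity + `hGateAll_conj_zOn_apply`. [cite: RajakumarWatsonLiu2025, §5.1 (proof of Theorem 13)] -/
theorem dephaseIsOutputBitflip_holds : DephaseIsOutputBitflip := by
  intro N η j σ w
  have hlin : hGateAll N * dephase η j σ * hGateAll N =
      ((1 - η : ℝ) : ℂ) • (hGateAll N * σ * hGateAll N) +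
        ((η : ℝ) : ℂ) • (hGateAll N * (zOn j * σ * zOn j) * hGateAll N) := by
    unfold dephase
    rw [Matrix.mul_add, Matrix.add_mul, Matrix.mul_smul, Matrix.smul_mul, Matrix.mul_smul, Matrix.smul_mul]
  unfold bornDiag
  rw [hlin, Matrix.add_apply, Matrix.smul_apply, Matrix.smul_apply, hGateAll_conj_zOn_apply, smul_eq_mul,
    smul_eq_mul, Complex.add_re, Complex.mul_re, Complex.mul_re, Complex.ofReal_re, Complex.ofReal_im,
    Complex.ofReal_re, Complex.ofReal_im]
  ring

/-! ## §5 The typed line `IQPBitflipPercolationThreshold` -/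

/-- LINE RECORD `IQPBitflipPercolationThreshold` (cell qa-dq, line `iqp-bitflip-percolation-threshold`): exact
open-set / pinning / component decomposition of the bit-flipped IQP distribution (A′, B, C) + the explicit expected
brute-force currency `E[Σ_v 2^{|C(v)|}] ≤ N/μ` of site percolation on a graph of maximum degree `Δ` for
`Δq ≤ μ`, `2μe^{1−μ} ≤ 1` (`LambertThreshold` of `ClusterExponentialMoment`; `q = 1 − 2η` the open-wire
probability) + the dephasing ↔ bit-flip dictionary (E2, E3). Nothing here is a complexity statement.
[cite: RajakumarWatsonLiu2025, Theorem 1, Lemma 5, Lemma 8 and Corollary 19] -/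
def IQPBitflipPercolationThreshold : Prop :=
  NoisyIsErasureMixture ∧ PinningIdentity ∧ ComponentFactorisation ∧ LambertThreshold ∧
    DephaseCompose ∧ DephaseIsOutputBitflip

/-- The line record holds (every conjunct is proved in this file or in `ClusterExponentialMoment`).
[cite: RajakumarWatsonLiu2025, Theorem 1, Lemma 5, Lemma 8 and Corollary 19] -/
theorem iqpBitflipPercolationThreshold_holds : IQPBitflipPercolationThreshold :=
  ⟨noisyIsErasureMixture_holds, pinningIdentity_holds, componentFactorisation_holds, lambertThreshold_holds,
    dephaseCompose_holds, dephaseIsOutputBitflip_holds⟩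

/-- The animal-level variant: the same decomposition with the lattice-animal threshold
`4(Δ+1)²q ≤ 1 ⟹ E[cost] ≤ N(1+4q)` (`AnimalRung`) in place of the Lambert threshold.
[cite: RajakumarWatsonLiu2025, Theorem 1, Lemma 5 and Lemma 8] -/
theorem iqpBitflipAnimalThreshold_holds :
    NoisyIsErasureMixture ∧ PinningIdentity ∧ ComponentFactorisation ∧ AnimalRung ∧
      DephaseCompose ∧ DephaseIsOutputBitflip :=
  ⟨noisyIsErasureMixture_holds, pinningIdentity_holds, componentFactorisation_holds, animalRung_holds,
    dephaseCompose_holds, dephaseIsOutputBitflip_holds⟩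

/-! ## §6 Depth ceiling (D3, D3′): the dephasing depth beyond which the open rate is subcritical

With `d` layers of dephasing of rate `p` the open-wire rate is `q = 1 − 2η_d = (1 − 2p)^d` (records E2/E3); since
`1 − 2p ≤ e^{−2p}`, `log(Δ/μ) ≤ 2pd` already forces `Δq ≤ μ`, and with `lambertThreshold_holds` this is a
SUFFICIENT DEPTH beyond which the expected brute-force currency is `≤ N/μ` for diagonal circuits under dephasing
(the printed form is the depth threshold `d* = O(p⁻¹ log(k p⁻¹))` of [RajakumarWatsonLiu2025, Corollary 19 and
Lemma 20]); e.g. `Δ = 4`, `p = 10⁻²`, `μ = μ⋆` gives `d ≥ 143`. This is a statement about one cost functional in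
one noise model — not an advantage / no-advantage statement. -/

/-- Record (D3) DEPTH CEILING: `0 ≤ p ≤ 1/2`, `0 < μ`, `log(Δ/μ) ≤ 2·p·d ⟹ Δ·(1 − 2p)^d ≤ μ`
(`1 − 2p ≤ e^{−2p}`). [cite: RajakumarWatsonLiu2025, Corollary 19 and Lemma 20] -/
def DepthCeiling : Prop :=
  ∀ (Δ d : ℕ) (p μ : ℝ), 0 ≤ p → p ≤ 1 / 2 → 0 < μ → Real.log (Δ / μ) ≤ 2 * p * d →
    (Δ : ℝ) * (1 - 2 * p) ^ d ≤ μ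

/-- Record (D3′) DEPTH–LAMBERT THRESHOLD (D3 + `LambertThreshold` at `q = (1 − 2p)^d`): maximum degree `≤ Δ`,
`0 ≤ p ≤ 1/2`, `0 < μ ≤ 1`, `2μe^{1−μ} ≤ 1`, `log(Δ/μ) ≤ 2pd ⟹ E[cost at open rate (1 − 2p)^d] ≤ N/μ` — a
sufficient depth beyond which the expected brute-force currency is `≤ N/μ` for diagonal circuits under dephasing;
not an advantage / no-advantage statement. [cite: RajakumarWatsonLiu2025, Theorem 1, Corollary 19 and Lemma 20] -/
def DepthLambertThreshold : Prop :=
  ∀ {N : ℕ} (G : SimpleGraph (Fin N)) [DecidableRel G.Adj] (Δ d : ℕ) (p μ : ℝ),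
    (∀ v, G.degree v ≤ Δ) → 0 ≤ p → p ≤ 1 / 2 → 0 < μ → μ ≤ 1 → 2 * μ * Real.exp (1 - μ) ≤ 1 →
      Real.log (Δ / μ) ≤ 2 * p * d →
        Literature.Probability.Percolation.ClusterExponentialMoment.expBruteCost G ((1 - 2 * p) ^ d) ≤ N / μ

/-- Record (D3), proved: `(1 − 2p)^d ≤ e^{−2pd} ≤ e^{−log(Δ/μ)} = μ/Δ`.
[cite: RajakumarWatsonLiu2025, Corollary 19 and Lemma 20] -/
theorem depthCeiling_holds : DepthCeiling := by
  intro Δ d p μ hp0 hp1 hμ hlog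
  have hq0 : 0 ≤ 1 - 2 * p := by linarith
  rcases Nat.eq_zero_or_pos Δ with hΔ | hΔ
  · subst hΔ; simp only [Nat.cast_zero, zero_mul]; exact hμ.le
  have hΔr : (0 : ℝ) < Δ := by exact_mod_cast hΔ
  have h1 : (1 - 2 * p) ^ d ≤ Real.exp (-(2 * p)) ^ d :=
    pow_le_pow_left₀ hq0 (by linarith [Real.add_one_le_exp (-(2 * p))]) d
  have h2 : Real.exp (-(2 * p)) ^ d = Real.exp (-(2 * p * d)) := by
    rw [← Real.exp_nat_mul]; congr 1; ring
  have h3 : Real.exp (-(2 * p * d)) ≤ Real.exp (-Real.log (Δ / μ)) :=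
    Real.exp_le_exp.2 (by linarith)
  have h4 : Real.exp (-Real.log (Δ / μ)) = μ / Δ := by
    rw [Real.exp_neg, Real.exp_log (div_pos hΔr hμ), inv_div]
  have hq : (1 - 2 * p) ^ d ≤ μ / Δ := by
    calc (1 - 2 * p) ^ d ≤ Real.exp (-(2 * p)) ^ d := h1
      _ = Real.exp (-(2 * p * d)) := h2
      _ ≤ Real.exp (-Real.log (Δ / μ)) := h3
      _ = μ / Δ := h4
  calc (Δ : ℝ) * (1 - 2 * p) ^ d ≤ Δ * (μ / Δ) := mul_le_mul_of_nonneg_left hq hΔr.le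
    _ = μ := mul_div_cancel₀ μ hΔr.ne'

/-- Record (D3′), proved: D3 composed with `lambertThreshold_holds`.
[cite: RajakumarWatsonLiu2025, Theorem 1, Corollary 19 and Lemma 20] -/
theorem depthLambertThreshold_holds : DepthLambertThreshold := by
  intro N G _ Δ d p μ hdeg hp0 hp1 hμ hμ1 hμe hlog
  have hq0 : 0 ≤ (1 - 2 * p) ^ d := pow_nonneg (by linarith) d
  have hq1 : (1 - 2 * p) ^ d ≤ 1 := pow_le_one₀ (by linarith) (by linarith)
  exact lambertThreshold_holds G Δ _ μ hdeg hq0 hq1 hμ hμ1 hμe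
    (depthCeiling_holds Δ d p μ hp0 hp1 hμ hlog)

end Literature.Computability.QuantumComplexity.NoisyIQPPercolation

end

/-! ## `_holds` aliases (appended 2026-08-28)

The named fact(s) below are already theorems of the tree under a differently-cased `_holds` name; the exact-name `_holds`
alias records the discharge under the tree's naming convention (D-0026 bookkeeping: proof term =
the existing theorem, no statement or definition edited). -/

/-- `IQPBitflipPercolationThreshold` is a theorem of the tree (`Literature.Computability.QuantumComplexity.NoisyIQPPercolation.iqpBitflipPercolationThreshold_holds`). [cite: RajakumarWatsonLiu2025, Theorem 1, Lemma 5, Lemma 8 and Corollary 19] -/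
theorem _root_.Literature.Computability.QuantumComplexity.NoisyIQPPercolation.IQPBitflipPercolationThreshold_holds : _root_.Literature.Computability.QuantumComplexity.NoisyIQPPercolation.IQPBitflipPercolationThreshold :=
  _root_.Literature.Computability.QuantumComplexity.NoisyIQPPercolation.iqpBitflipPercolationThreshold_holds
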